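import Literature.NumberTheory.Automorphic.Sweep1SymmetricPowerGelbartProofs
import Literature.NumberTheory.Automorphic.AdelicGroupDataAutomorphicMeasureProofs
import HarnessLib

/-!
# Gelbart's dictionary holds; lang.S24 is equivalent to Newton–Thorne's Thm. A outright

Sibling proof file (theorems only, no `sorry`, no named fact) of
`Literature.NumberTheory.Automorphic.Sweep1SymmetricPower` and
`Literature.NumberTheory.Automorphic.Sweep1` (lang.S24,
`Literature.NumberTheory.Automorphic.exists_cuspidal_symmetricPower`).

`Sweep1SymmetricPowerGelbartProofs` reduced Gelbart's dictionary
`Gelbart1975_exists_isAutomorphicRepOf` (Gelbart (1975), Thm. 5.19 (a); Bump (1997),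
Thm. 3.6.1: *a newform `f ∈ S_k(Γ₁(N))`, `k ≥ 2`, has a cuspidal automorphic representation
`π_f ≤ L²_cusp(GL₂(𝔸_ℚ) ⧸ A_G GL₂(ℚ), μ)` whose Satake pair at almost every `p` is the unitary
Satake pair of `f`*) to one trunk statement, Borel–Harish-Chandra finiteness for `GL₂` over `ℚ`
(`AdelicGroupData.exists_isAutomorphicMeasure_gl 2 ℚ`: the automorphic quotient
`GL₂(𝔸_ℚ) ⧸ A_G GL₂(ℚ)` carries a finite, open-positive, inner regular, invariant measure;
Borel (1963), Thm. 5.8), everything else — the adelisation `φ_f` of `f`, its cuspidality and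
Hecke eigenvalues (Gelbart, Prop. 3.1 (vii), Lemma 3.7), the projection to an irreducible
constituent (proof of Thm. 5.19, p. 62), and the discrete decomposability of `L²_cusp`
(Gelfand–Graev–Piatetski-Shapiro) — being theorems of the tree. That trunk statement is now the
theorem `AdelicGroupData.exists_isAutomorphicMeasure_gl_holds` of
`AdelicGroupDataAutomorphicMeasureProofs` (reduction theory and the finite volume of Siegel
sets, for every `GL_n` over every number field). This file feeds it in:

* `Gelbart1975_exists_isAutomorphicRepOf_holds` — **the discharge of the named fact
  `Gelbart1975_exists_isAutomorphicRepOf`** (Gelbart, Thm. 5.19 (a)), sorry-free;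
* `exists_cuspidal_symmetricPower_one'` — **the case `m = 1` of lang.S24 holds outright**
  (`Sym¹ π_f = π_f`; `exists_cuspidal_symmetricPower_one` of `Sweep1SymmetricPower` with its
  hypothesis, Gelbart's dictionary, discharged);
* `exists_cuspidal_symmetricPower_of_newtonThorne2021'`,
  `exists_cuspidal_symmetricPower_iff_newtonThorne2021'` — **lang.S24
  (`exists_cuspidal_symmetricPower`) is equivalent, with no further hypothesis, to the weak-lift
  form `NewtonThorne2021_exists_cuspidal_symmPowerLift` of Newton–Thorne's Thm. A**
  (`exists_cuspidal_symmetricPower_iff_newtonThorne2021` of `Sweep1SymmetricPowerProofs` with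
  its hypothesis, Gelbart's dictionary, discharged; equivalently
  `exists_cuspidal_symmetricPower_iff_newtonThorne2021_of_exists_isAutomorphicMeasure` of
  `Sweep1SymmetricPowerGelbartProofs` fed with Borel–Harish-Chandra finiteness).

So the one statement on which lang.S24 still rests is Newton–Thorne's theorem itself
(J. Newton, J. A. Thorne, Publ. Math. IHÉS 134 (2021), part II, Thm. A = Thm. 3.1: for `π`
regular algebraic cuspidal on `GL₂(𝔸_ℚ)` and non-CM, `Symⁿ π` is cuspidal automorphic on
`GL_{n+1}(𝔸_ℚ)` for every `n ≥ 1`; proved there by a new automorphy lifting theorem for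
symmetric power representations, Thm. 2.1, and the 'killing ramification' induction of §3 on
top of part I), whose Galois-theoretic proof has no carrier on the present tree: the discharge
`exists_cuspidal_symmetricPower_holds` is exactly
`exists_cuspidal_symmetricPower_iff_newtonThorne2021'.mpr h` for a proof `h` of
`NewtonThorne2021_exists_cuspidal_symmPowerLift`.

## References

* S. Gelbart, *Automorphic forms on adele groups*, Ann. of Math. Stud. 83 (1975), §5.C,
  Lemma 5.16, (5.17)–(5.18), Thm. 5.19, p. 62 [Gelbart1975].
* D. Bump, *Automorphic forms and representations* (1997), Thm. 3.6.1 and its proof,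
  pp. 338–342 [Bump1997].
* A. Borel, *Some finiteness properties of adele groups over number fields*, Publ. Math. IHÉS 16
  (1963), Thm. 5.8 [Borel1963].
* J. Newton, J. A. Thorne, *Symmetric power functoriality for holomorphic modular forms, II*,
  Publ. Math. IHÉS 134 (2021), Thm. A (= Thm. 3.1) and §1, p. 117 [NewtonThorneIHES2021b].
-/

noncomputable section

open NumberField IsDedekindDomain MeasureTheory

namespace Literature.NumberTheory.Automorphic

open EllipticCurves.ModularForms

variable {N : ℕ} [NeZero N] {k : ℤ}

/-- **Gelbart's dictionary holds** (Gelbart (1975), Thm. 5.19 (a) with Lemma 5.16, (5.18),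
p. 62; Bump (1997), Thm. 3.6.1): discharge of the named fact
`Gelbart1975_exists_isAutomorphicRepOf` of `Sweep1SymmetricPower` — *every newform
`f ∈ S_k(Γ₁(N))` of weight `k ≥ 2` has, for some automorphic measure `μ` on
`GL₂(𝔸_ℚ) ⧸ A_G GL₂(ℚ)`, a cuspidal automorphic representation `P ≤ L²_cusp(μ)` which is the
automorphic representation of `f` (`IsAutomorphicRepOf f P`: at the level `K(N)` and almost
every `p`, `P` has the unitary Satake pair `{α, β}` of `f`, `α + β = a_p p^{-(k-1)/2}`,
`αβ = χ_f(p)`)*. Proof: `Gelbart1975_exists_isAutomorphicRepOf_of_exists_isAutomorphicMeasure`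
(`Sweep1SymmetricPowerGelbartProofs`: adelisation, cuspidality, Hecke eigenvalues, projection to
an irreducible constituent and discrete decomposability of `L²_cusp`, all proved) applied to
Borel–Harish-Chandra finiteness for `GL₂` over `ℚ`, the theorem
`AdelicGroupData.exists_isAutomorphicMeasure_gl_holds 2 ℚ` (Borel (1963), Thm. 5.8).
[cite: Gelbart1975, Thm. 5.19 (a) and Lemma 5.16, (5.18)] [cite: Bump1997, Thm. 3.6.1]
[cite: Borel1963, Thm. 5.8] -/
theorem Gelbart1975_exists_isAutomorphicRepOf_holds :
    Gelbart1975_exists_isAutomorphicRepOf (N := N) (k := k) :=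
  Gelbart1975_exists_isAutomorphicRepOf_of_exists_isAutomorphicMeasure
    (AdelicGroupData.exists_isAutomorphicMeasure_gl_holds 2 ℚ)

/-- **The case `m = 1` of lang.S24 holds outright: `Sym¹ π_f = π_f`** (Gelbart (1975),
Thm. 5.19 (a)): for every newform `f ∈ S_k(Γ₁(N))` of weight `k ≥ 2` there are an automorphic
measure `μ` on `GL₂(𝔸_ℚ) ⧸ A_G GL₂(ℚ)`, a cuspidal automorphic representation `P ≤ L²_cusp(μ)`
and a level `𝔫 ≠ 0` such that at almost every `p ∤ 𝔫` the representation `P` has Satake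
parameter `{α⁰β¹, α¹β⁰} = {α, β}` with `α + β = a_p p^{-(k-1)/2}`, `αβ = χ_f(p)` — the clause of
`exists_cuspidal_symmetricPower` at `m = 1`, for every newform (CM or not). This is
`exists_cuspidal_symmetricPower_one` of `Sweep1SymmetricPower` with its hypothesis, Gelbart's
dictionary, discharged by `Gelbart1975_exists_isAutomorphicRepOf_holds`.
[cite: Gelbart1975, Thm. 5.19 (a)] -/
theorem exists_cuspidal_symmetricPower_one' (hk : 2 ≤ k)
    {f : CuspForm (CongruenceSubgroup.Gamma1 N) k} (hf : IsNewform1 f) :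
    ∃ (μ : Measure (AdelicGroupData.gl 2 ℚ).automorphicQuotient)
      (_ : (AdelicGroupData.gl 2 ℚ).IsAutomorphicMeasure μ)
      (P : CuspidalAutomorphicRepGL 2 ℚ μ) (𝔫 : Ideal (𝓞 ℚ)) (_ : 𝔫 ≠ 0),
      ∀ᶠ v : HeightOneSpectrum (𝓞 ℚ) in Filter.cofinite,
        ¬ v.asIdeal ∣ 𝔫 ∧ ∃ α β : ℂ,
          α + β = heckeEigenvalue f (Rat.HeightOneSpectrum.primesEquiv v) /
              (((Real.sqrt (Rat.HeightOneSpectrum.primesEquiv v : ℕ) : ℝ) : ℂ) ^ (k - 1)) ∧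
          α * β = nebentypus f (Rat.HeightOneSpectrum.primesEquiv v : ℕ) ∧
          ∃ ϖ : (v.adicCompletion ℚ)ˣ,
            HasSatakeParameterAt P.1 (principalCongruenceLevel 2 ℚ 𝔫) v ϖ
              ((Multiset.range 2).map fun i => α ^ i * β ^ (1 - i)) :=
  exists_cuspidal_symmetricPower_one Gelbart1975_exists_isAutomorphicRepOf_holds hk hf

/-- **lang.S24 from Newton–Thorne's Thm. A alone**: the weak-lift form
`NewtonThorne2021_exists_cuspidal_symmPowerLift` of Newton–Thorne's theorem (for `f` a non-CM
newform of weight `k ≥ 2`, `P` its cuspidal automorphic representation and `m ≥ 1`, a cuspidal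
weak `Symᵐ`-lift `Q` of `P` on `GL_{m+1}(𝔸_ℚ)` exists) implies `exists_cuspidal_symmetricPower`,
with no further hypothesis — `exists_cuspidal_symmetricPower_of_symmPowerLift'` of
`Sweep1SymmetricPowerProofs` (Gelbart's dictionary, the lift, and Satake parameters of cuspidal
representations at one level almost everywhere) with Gelbart's dictionary discharged by
`Gelbart1975_exists_isAutomorphicRepOf_holds`. [cite: NewtonThorneIHES2021b, Thm. A] -/
theorem exists_cuspidal_symmetricPower_of_newtonThorne2021'
    (hNT : NewtonThorne2021_exists_cuspidal_symmPowerLift (N := N) (k := k)) :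
    exists_cuspidal_symmetricPower (N := N) (k := k) :=
  exists_cuspidal_symmetricPower_of_symmPowerLift' Gelbart1975_exists_isAutomorphicRepOf_holds hNT

/-- **lang.S24 is equivalent to the weak-lift form of Newton–Thorne's Thm. A, outright**:
`exists_cuspidal_symmetricPower ↔ NewtonThorne2021_exists_cuspidal_symmPowerLift` with no
hypothesis — `exists_cuspidal_symmetricPower_iff_newtonThorne2021` of
`Sweep1SymmetricPowerProofs` (the converse `newtonThorne2021_of_exists_cuspidal_symmetricPower`
is unconditional: Vieta on the Satake pair and the one-pair-of-levels criterion for weak lifts)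
with Gelbart's dictionary discharged by `Gelbart1975_exists_isAutomorphicRepOf_holds`. Hence the
vendored named fact lang.S24 and the Newton–Thorne fact are one and the same statement on the
tree, and `exists_cuspidal_symmetricPower_holds` is `this.mpr h` for any proof `h` of
`NewtonThorne2021_exists_cuspidal_symmPowerLift` (Newton–Thorne II, Thm. A = Thm. 3.1, whose
proof — Thm. 2.1 and §3 of the source on top of part I — is not carried by the tree).
[cite: NewtonThorneIHES2021b, Thm. A (= Thm. 3.1) and §1 (p. 117)] -/
theorem exists_cuspidal_symmetricPower_iff_newtonThorne2021' :
    exists_cuspidal_symmetricPower (N := N) (k := k) ↔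
      NewtonThorne2021_exists_cuspidal_symmPowerLift (N := N) (k := k) :=
  exists_cuspidal_symmetricPower_iff_newtonThorne2021 Gelbart1975_exists_isAutomorphicRepOf_holds

end Literature.NumberTheory.Automorphic
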